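import Literature.MathematicalPhysics.QuantumFieldTheory.Balaban1983to89.Node00.OpsYRead342Cross
import Literature.MathematicalPhysics.QuantumFieldTheory.Balaban1983to89.B9SectBGReadY

/-!
# `Balaban1983to89.Node00.OpsYRead342CrossB` — THE TWO CROSS ORIENTATION COMBOS OF (3.42) ON THE BOND SECTOR (Thm 3.3 p. 399) AT ONE CONFIGURATION:
# `‖(∇*_{V,ν}O(V)(J ⊗ E))(x)‖` (backward difference on the LEFT of the letter) and `‖(O(V)∇_{V,ν}(J ⊗ E))(x)‖` (forward difference on the RIGHT),
# bounded by `C·B₀·ℓ(y)·e^{−δd(y,y′)}·|J|` from the (3.42) block `EBlock (Node00.kernelFamilyB i B cfg O par) B₀ δ U₁` of NODE 00's bond-sector reading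
# (which carries print's two orientations only: `∇_U G` forward-LEFT, `G∇*_U` backward-RIGHT), with the constants `C_L = L·e^{2(d+1)|δ|}` and
# `C_R = m_N·M₂(Σ_j‖b_j‖)·e^{2(d+1)|δ|}` of the site-sector twin `Node00.OpsYRead342Cross`; plus the two [4]-(2.51) block majorants of the real-coordinate
# letters `conj b (∇*_{V,ν} ∘ O(V))` and `conj b (O(V) ∘ ∇_{V,ν})` on the bond carrier `FBondY × ι` (dag-n06-c WORD-3: the two cross slots of r06's G frame
# `B9SectBGFrameV4.GFrame₄.readG342`, `∀ k : κ ⊕ κ`, on the bond sector)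

T. Bałaban, *Propagators for lattice gauge theories in a background field*, Commun. Math. Phys. **99** (1985) 389–434 [`Balaban1985BackgroundPropagators`,
"B9"]; [4] = T. Bałaban, *Propagators and renormalization transformations for lattice gauge theories. II*, Commun. Math. Phys. **96** (1984) 223–250
[`Balaban1984PropagatorsII`].

statement-level skeleton of published theorems with citation tags; proofs where landed; nothing here is a claim about the Yang–Mills mass gap

THE PRINTED LOCI.  Thm 3.3 p. 399: *"G(U) = (Δ(U) + Q*aQ + DR₀ΛD*)⁻¹ satisfies (3.42)–(3.47) with ζ = 0"*; (3.42) p. 397: *"|(G′(U)λ)(x)|, |(∇_U G′(U)λ)(x)|,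
|(G′(U)∇*_U λ)(x)|, |(Δ_U G′(U)λ)(x)| ≤ B₀[(Lʲη)², Lʲη, Lʲη, 1]e^{−δ₀d(y,y′)}|λ| for x ∈ Δ(y), y ∈ Λ_j, supp λ ⊂ Δ(y′)"* — four entries, `∇_U` on the LEFT and
`∇*_U` on the RIGHT only (lit-balaban-r06 QUOTATION CHECK #9); (3.3) p. 390 `(∇_{U,μ}A)_ν(x) = c_f[R(U(x,x+e_μ))A_ν(x+e_μ) − A_ν(x)]` (physical units `c_f`,
def-Y's `cdB`); (3.8) p. 392 with (3.5) p. 391: `(∇*_{U,μ}A)_ν(x) = c_f[R(U(x−e_μ,x))⁻¹A_ν(x−e_μ) − A_ν(x)]` (def-Y's `cdsB`), i.e. `∇*_μ = −R(U⁻¹)τ_{−μ}∇_μ`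
(`B9Eq371Composition.covDstar_eq_neg_R_covD`) and `∇_μ = −∇*_μ∘T_μ` with the covariant forward transport-shift `(T_μA)_ν(x) = R(U(x,x+e_μ))A_ν(x+e_μ)`
acting on the source variable, the direction `ν` carried passively; [4] (2.2) p. 224 + Lemma 2.1 (2.60)–(2.61) p. 234; [4] (2.51) p. 232.

WHY THIS FILE (cell `pub-ymgap`, N06 row 13, G side; seat `pub-ymgap-node00-def-Y` gen 25, the OpsY-instance owner; dag-n06-c g13's WORD-3, fleet bus
I.≈42714 ∕ INTENT-63 I.42810).  r06's G frame asks, at a regular base and for EVERY difference letter `k : κ ⊕ κ`, block majorants of BOTH `letter_k * G_b U`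
and `G_b U * letter_k`; besides print's second and third members (read off the bond-sector family by dag-n06-c's `B9SectBGReadY.hasMajorant_conj_cdB_O_of_eBlockB`
∕ `…_conj_O_cdsB_of_eBlockB`) this includes the two CROSS combos `∇*_{U,ν}∘G(U)` and `G(U)∘∇_{U,ν}`, «of course with different constants» (p. 403).  Gen 14's
`Node00.OpsYRead342Cross` supplied them on the SITE sector; this file is its bond-sector twin, in dag-n06-c's currency (`cdBₗ ∕ cdsBₗ` of `B9CoReadingCoords`,
block map `ι_B ∘ blkV1 ∘ fst`, `hM₂ ∕ hrepr`), proved by the SAME two moves: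
* §1 TRANSPORT IDENTITIES at def-Y's bond-sector differences (all `theorem`s, the shifted bond written out as `⟨x₋ ∓ e_ν, dir x⟩`): `cdsB_apply_eq_neg_R_cdB`
  (`(∇*_νA)(x) = −R(U_ν(x₋−e_ν))⁻¹(∇_νA)(⟨x₋−e_ν, dir x⟩)`), `norm_cdsB_le_norm_cdB_unshift` (under unit norms of the bond variables the backward difference at `x` is
  bounded by the forward one at the shifted bond), ★ `cdB_eq_neg_cdsB_transport` (`∇_ν = −∇*_ν∘T_ν`), `transportB_liftY_eq_sum` (`T_ν(J ⊗ E) = Σ_j g_j ⊗ b_j`,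
  `g_j(x) = J(⟨x₋+e_ν, dir x⟩)·repr_j(R(U_ν(x₋))E)`).
* §2 CHART ∕ GEOMETRY of the one-step shift of a bond: `blkC_boxEquiv_src` (`ι_B(blkV1 x) = blkC ι_B (boxEquiv x₋)`, `rfl`), `boxEquiv_shiftsV1 ∕ _symm` (the chart
  intertwines the torus shifts `shiftsV1` with `shiftY`, by `B6ScalarChartV1.toBox_shift` — as `Node00.OpsYGauge.boxEquiv_symm_shiftY`), hence from dag-n06-c's stencils `stencilF_blkC ∕ stencilB_blkC`
  and gen 14's `len_blkC_symm_shift_le`: `dist_blkV1_shift_le ∕ dist_blkV1_unshift_le` (`≤ 2(d+1)`), `len_blkV1_unshift_le` (`ℓ(Δ(x₋−e_ν)) ≤ L·ℓ(Δ(x₋))` once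
  `2(d+1) < M`).
* §3 ★★ LEFT-BACKWARD CROSS ENTRY `norm_cdsB_O_le_of_eBlockB_cross`: `‖(∇*_{V,ν}O(V)(J ⊗ E))(x)‖ ≤ L·e^{2(d+1)|δ|}·B₀ℓ(y)e^{−δd(y,y′)}|J|` for `‖E‖ ≤ 1`,
  `supp J ⊂ Δ(βy′)`, `x ∈ Δ(βy)` (print's second member read at the neighbour bond `⟨x₋−e_ν, dir x⟩`).
* §4 ★★ RIGHT-FORWARD CROSS ENTRY `norm_O_cdB_le_of_eBlockB_cross`: `‖(O(V)∇_{V,ν}(J ⊗ E))(x)‖ ≤ m_N·M₂(Σ_j‖b_j‖)·e^{2(d+1)|δ|}·B₀ℓ(y)e^{−δd(y,y′)}|J|`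
  (print's third member applied to the BLOCK PIECES of the transported amplitude over the radius-`2(d+1)` neighbourhood `B9RWSumsReadsNbr.nbr` of `y′`; `m_N`
  bounds the neighbourhood count — discharged uniformly by `B9GeoNbrCountKLevelV1.exists_card_nbr_geo9K_le`, as in gen 14's file).
* §5 ★★ THE TWO WANTED (2.51) BLOCK MAJORANTS, in the exact shape of `B9SectBGReadY` §3: `hasMajorant_conj_cdsB_O_of_eBlockB` (`conj b (cdsBₗ ∘ₗ O)`, constant
  `L·e^{2(d+1)|δ|}·B₀` inside `M₂(Σ_j‖b_j‖)·(…)`, profile `ℓ(a)`, SAME rate `δ`) and `hasMajorant_conj_O_cdB_of_eBlockB` (`conj b (O ∘ₗ cdBₗ)`, constant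
  `m_N·M₂(Σ_j‖b_j‖)·e^{2(d+1)|δ|}·B₀`).
Hypotheses beyond `B9SectBGReadY` §3's (rate `δ` of EITHER sign): unit norms `‖U_ν(s)‖ ≤ 1`, `‖U_ν(s)⁻¹‖ ≤ 1` of the bond variables `cfg U₁ ν s` at the torus sites
(at the record: `G`-valued configurations, `G ≤ U(N)`); the threshold `2(d+1) < M`; for §4∕§5-right the count `m_N`.  CORNER-FREE MEMBERS ONLY (a SECTION `ι_B`
of `β`, `hι`), as in every (2.51) reading of the lineage.

HONEST SCOPE.  Finite-dimensional linear algebra, the two transport identities and sup bookkeeping over def-Y's definitions and dag-n06-c's pointwise reads;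
every bound is an identity-level consequence of the cited shapes with the constants displayed; nothing of [B9] Thm 3.3 or [4] Lemma 2.1 is asserted (the level
gap and the neighbourhood count are CITED from the tree); no definition, no `instance`, no `notation`; COUNT-NEUTRAL; N06 NOT discharged; `GFrame₄ ∕ readG342 ∕
KACU` are r06's ∕ dag-n06-c's and not touched; one finite 𝕋⁴ programme at fixed ε — nothing continuum, nothing about the mass gap.  Cell `pub-ymgap` (HUMAN RULING
D-0062), Track A node N06 [B9], seat `pub-ymgap-node00-def-Y` (g25), 2026-08-28.

RELATED IN THE TREE, NOT DUPLICATED: `Node00.OpsYRead342Cross` (the site-sector twin, imported for its closure and `len_blkC_symm_shift_le`), `B9SectBGReadY`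
(dag-n06-c's print-orientation reads and majorants of the bond sector), `B9Thm310CommutatorBound389BMajorant.hasMajorant_conj_of_ball_boundB` (the (2.51) core on
bonds), `B9SectBGpLettersY` (`blkC`, the stencils), `B6ScalarChartV1.toBox_shift` — USED BY NAME (`Node00.OpsYGauge.boxEquiv_symm_shiftY`, the inverse-chart
form of §2's `boxEquiv_shiftsV1`, is not in this file's import closure and is re-derived in two lines); no existing module modified.
-/

namespace Literature.MathematicalPhysics.QuantumFieldTheory.Balaban1983to89.Node00.OpsYRead342CrossB

open B6GlobalChartV1 (PV boxEquiv boxEquiv_apply blkV1 toBox)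
open B6ScalarChartV1 (toBox_shift)
open B6Geom246MultiLevelBox (bset blkOf)
open B6Ineq2142KLevelV1 (β)
open B6KLevelCensusIndexV1 (KIdx kGeo)
open B6RandomWalk (HasMajorant hasMajorant_mono)
open B9Thm34Ext (toB6)
open B9FromB6 (EBlock)
open B9GeoNormsKLevelV1 (geo9K)
open B9GeoLemma21KLevelV1 (geo9K_dist_comm geo9K_dist_triangle geo9K_len_pos)
open B9BackgroundsKLevelV1 (CfgV1 shiftsV1)
open B9Eq39Adjoint (R R_smul R_inv_R covD covDstar)
open B9Eq310Hermitian (norm_R_le)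
open B9Eq371Composition (covDstar_eq_neg_R_covD)
open B9Eq352DivFormLetters (conj)
open B9Ineq349SiteComposite (norm_le_norm_mul_of_ball)
open B9SectBGpLettersY (blkC stencilF_blkC stencilB_blkC)
open B9RWSumsReadsNbr (nbr mem_nbr)
open B9CoReadingCoords (cdBₗ cdsBₗ cdBₗ_apply cdsBₗ_apply)
open B9CubeLettersInvReadDictBMajorants (cdB_smul cdsB_smul)
open B9Thm310CommutatorBound389BMajorant (hasMajorant_conj_of_ball_boundB)
open B9SectBGReadY (norm_cdB_O_le_of_eBlockB norm_O_cdsB_le_of_eBlockB)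
open OpsYRead342 (geo9K_len_congr geo9K_dist_congr liftY_smul_right)
open OpsYRead342Cross (len_blkC_symm_shift_le)

variable {d ℓ : ℕ} {hd : 1 ≤ d + 1} {hL : Odd (ℓ + 1) ∧ 1 < ℓ + 1} {b₀ b₁ : ℝ}
variable {𝔸 : Type} [NormedRing 𝔸] [NormedAlgebra ℂ 𝔸] [CompleteSpace 𝔸]
variable {ι : Type} [Fintype ι]
variable (i : KIdx d ℓ hd hL b₀ b₁) (b : Module.Basis ι ℝ 𝔸)

/-! ## §1 Transport identities at def-Y's bond-sector covariant differences -/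

section Transport

variable (V : CfgY 𝔸 i)

omit [Fintype ι] in
/-- `∇*_{V,ν} = −R(U_ν(x₋−e_ν))⁻¹ τ_{−ν} ∇_{V,ν}` at def-Y's bond operators, pointwise: `(∇*_νA)(x) = −R(U_ν(x₋−e_ν))⁻¹((∇_νA)(⟨x₋−e_ν, dir x⟩))` (the
physical-unit prefactor `c_f` is common to both sides). [cite: Balaban1985BackgroundPropagators, (3.8) p.392, (3.5) p.391, (3.3) p.390] -/
theorem cdsB_apply_eq_neg_R_cdB (ν : Fin (d + 1)) (A : FBondY i → 𝔸) (x : FBondY i) :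
    cdsB i V ν A x = -R (V ν ((shiftsV1 (PV d ℓ i.m i.K hd hL) ν).symm x.src))⁻¹
      (cdB i V ν A ⟨(shiftsV1 (PV d ℓ i.m i.K hd hL) ν).symm x.src, x.dir⟩) := by
  show ((i.cf : ℝ) : ℂ) • covDstar (shiftsV1 (PV d ℓ i.m i.K hd hL)) V ν (fun s => A ⟨s, x.dir⟩) x.src =
    -R (V ν ((shiftsV1 (PV d ℓ i.m i.K hd hL) ν).symm x.src))⁻¹
      (((i.cf : ℝ) : ℂ) • covD (shiftsV1 (PV d ℓ i.m i.K hd hL)) V ν (fun s => A ⟨s, x.dir⟩) ((shiftsV1 (PV d ℓ i.m i.K hd hL) ν).symm x.src))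
  rw [covDstar_eq_neg_R_covD (shiftsV1 (PV d ℓ i.m i.K hd hL)) V ν (fun s => A ⟨s, x.dir⟩) x.src, R_smul, smul_neg]

omit [Fintype ι] in
/-- under unit norms of the bond variables (`‖U_ν(s)‖ ≤ 1`, `‖U_ν(s)⁻¹‖ ≤ 1`) the backward difference at `x` is bounded by the forward one at the shifted bond:
`‖(∇*_{V,ν}A)(x)‖ ≤ ‖(∇_{V,ν}A)(⟨x₋−e_ν, dir x⟩)‖`. [cite: Balaban1985BackgroundPropagators, (3.8) p.392, (3.5) p.391 (R(U) norm-preserving at unitary U)] -/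
theorem norm_cdsB_le_norm_cdB_unshift
    (hU1 : ∀ (ν : Fin (d + 1)) (s : Site (PV d ℓ i.m i.K hd hL) 0), ‖((V ν s : 𝔸ˣ) : 𝔸)‖ ≤ 1 ∧ ‖(((V ν s)⁻¹ : 𝔸ˣ) : 𝔸)‖ ≤ 1)
    (ν : Fin (d + 1)) (A : FBondY i → 𝔸) (x : FBondY i) :
    ‖cdsB i V ν A x‖ ≤ ‖cdB i V ν A ⟨(shiftsV1 (PV d ℓ i.m i.K hd hL) ν).symm x.src, x.dir⟩‖ := by
  rw [cdsB_apply_eq_neg_R_cdB, norm_neg]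
  refine norm_R_le (hU1 ν _).2 ?_ _
  rw [inv_inv]
  exact (hU1 ν _).1

omit [Fintype ι] in
/-- ★ **`∇_{V,ν} = −∇*_{V,ν}∘T_ν`** with the covariant forward TRANSPORT-SHIFT `(T_νA)(x) = R(U_ν(x₋))A(⟨x₋+e_ν, dir x⟩)` (source variable transported,
direction carried passively). [cite: Balaban1985BackgroundPropagators, (3.3) p.390, (3.8) p.392, (3.5) p.391] -/
theorem cdB_eq_neg_cdsB_transport (ν : Fin (d + 1)) (A : FBondY i → 𝔸) :
    cdB i V ν A = -cdsB i V ν (fun x' : FBondY i => R (V ν x'.src) (A ⟨shiftsV1 (PV d ℓ i.m i.K hd hL) ν x'.src, x'.dir⟩)) := by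
  funext x
  rw [Pi.neg_apply]
  show ((i.cf : ℝ) : ℂ) • covD (shiftsV1 (PV d ℓ i.m i.K hd hL)) V ν (fun s => A ⟨s, x.dir⟩) x.src =
    -(((i.cf : ℝ) : ℂ) • covDstar (shiftsV1 (PV d ℓ i.m i.K hd hL)) V ν
      (fun s => R (V ν s) (A ⟨shiftsV1 (PV d ℓ i.m i.K hd hL) ν s, x.dir⟩)) x.src)
  rw [← smul_neg]
  congr 1
  simp only [covD, covDstar, R_inv_R, Equiv.apply_symm_apply, neg_sub]

omit [CompleteSpace 𝔸] in
/-- lifts commute with finite sums of the scalar functions. [cite: Balaban1985BackgroundPropagators, (3.39) p.397, bookkeeping] -/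
private theorem liftY_finset_sum {X S : Type} (s : Finset S) (h : S → X → ℝ) (E : 𝔸) :
    liftY (∑ a ∈ s, h a) E = ∑ a ∈ s, liftY (h a) E := by
  classical
  induction s using Finset.induction_on with
  | empty => funext x; simp [liftY_apply]
  | insert a s ha ih => rw [Finset.sum_insert ha, Finset.sum_insert ha, liftY_add, ih]

end Transport

omit [CompleteSpace 𝔸] in
/-- ★ the transport-shift of a bond AMPLITUDE is a sum of amplitudes along the basis: `T_ν(J ⊗ E) = Σ_j g_j ⊗ b_j`,
`g_j(x) = J(⟨x₋+e_ν, dir x⟩)·repr_j(R(U_ν(x₋))E)` — stated for a bare configuration `V : CfgV1` (def-Y's `CfgY 𝔸 i` unfolds to it; the identity needs no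
completeness of `𝔸`). [cite: Balaban1985BackgroundPropagators, (3.39) p.397 + (3.3) p.390, bookkeeping] -/
theorem transportB_liftY_eq_sum (V : CfgV1 (PV d ℓ i.m i.K hd hL) 𝔸) (ν : Fin (d + 1)) (J : FBondY i → ℝ) (E : 𝔸) :
    (fun x' : FBondY i => R (V ν x'.src) (liftY J E ⟨shiftsV1 (PV d ℓ i.m i.K hd hL) ν x'.src, x'.dir⟩))
      = ∑ j, liftY (fun x' : FBondY i => J ⟨shiftsV1 (PV d ℓ i.m i.K hd hL) ν x'.src, x'.dir⟩ * b.repr (R (V ν x'.src) E) j) (b j) := by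
  funext x'
  rw [Finset.sum_apply, liftY_apply, R_smul]
  conv_lhs => rw [← b.sum_repr (R (V ν x'.src) E)]
  rw [Finset.smul_sum]
  refine Finset.sum_congr rfl fun j _ => ?_
  simp only [liftY_apply, Complex.ofReal_mul, mul_smul, Complex.coe_smul]

/-! ## §2 Chart and geometry of the one-step shift of a bond: lengths within a factor `L`, distances within `2(d+1)` -/

section Geometry

variable (ιB : BlkY i → IBondY i)

omit [NormedRing 𝔸] [NormedAlgebra ℂ 𝔸] [CompleteSpace 𝔸] [Fintype ι] in
/-- the labelled carrier block of a fine bond is dag-n06-c's `blkC` at the chart point of its source. [cite: Balaban1984PropagatorsII, (2.45) p.231, dictionary] -/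
theorem blkC_boxEquiv_src (x : FBondY i) : blkC i ιB (boxEquiv i.hN x.src) = ιB (blkV1 i.hN i.D x) := rfl

omit [NormedRing 𝔸] [NormedAlgebra ℂ 𝔸] [CompleteSpace 𝔸] [Fintype ι] in
/-- the chart intertwines the torus shift with the box-chart shift: `boxEquiv (s + e_ν) = shiftY ν (boxEquiv s)`. [cite: Balaban1984PropagatorsII, (2.1) p.224, dictionary] -/
theorem boxEquiv_shiftsV1 (ν : Fin (d + 1)) (s : Site (PV d ℓ i.m i.K hd hL) 0) :
    boxEquiv i.hN (shiftsV1 (PV d ℓ i.m i.K hd hL) ν s) = shiftY i ν (boxEquiv i.hN s) := by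
  show boxEquiv i.hN (s.shift ν) = _
  rw [boxEquiv_apply, toBox_shift, ← boxEquiv_apply]
  rfl

omit [NormedRing 𝔸] [NormedAlgebra ℂ 𝔸] [CompleteSpace 𝔸] [Fintype ι] in
/-- … and the backward shift: `boxEquiv (s − e_ν) = (shiftY ν)⁻¹ (boxEquiv s)`. [cite: Balaban1984PropagatorsII, (2.1) p.224, dictionary] -/
theorem boxEquiv_shiftsV1_symm (ν : Fin (d + 1)) (s : Site (PV d ℓ i.m i.K hd hL) 0) :
    boxEquiv i.hN ((shiftsV1 (PV d ℓ i.m i.K hd hL) ν).symm s) = (shiftY i ν).symm (boxEquiv i.hN s) := by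
  apply (shiftY i ν).injective
  rw [Equiv.apply_symm_apply, ← boxEquiv_shiftsV1, Equiv.apply_symm_apply]

omit [NormedRing 𝔸] [NormedAlgebra ℂ 𝔸] [CompleteSpace 𝔸] [Fintype ι] in
/-- the labelled block of the forward-shifted bond `⟨x₋+e_ν, dir x⟩` is within `2(d+1)` of that of `x` (dag-n06-c's stencil `stencilF_blkC`).
[cite: Balaban1984PropagatorsII, (2.46) p.231, (2.2) p.224] -/
theorem dist_blkV1_shift_le (hι : ∀ s, β i.hN i.D i.hk (ιB s) = s) (ν : Fin (d + 1)) (x : FBondY i) :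
    (geo9K i).dist (ιB (blkV1 i.hN i.D x)) (ιB (blkV1 i.hN i.D ⟨shiftsV1 (PV d ℓ i.m i.K hd hL) ν x.src, x.dir⟩)) ≤ 2 * ((d : ℝ) + 1) := by
  show (geo9K i).dist (blkC i ιB (boxEquiv i.hN x.src)) (blkC i ιB (boxEquiv i.hN (shiftsV1 (PV d ℓ i.m i.K hd hL) ν x.src))) ≤ _
  rw [boxEquiv_shiftsV1]
  exact stencilF_blkC i ιB hι ν _

omit [NormedRing 𝔸] [NormedAlgebra ℂ 𝔸] [CompleteSpace 𝔸] [Fintype ι] in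
/-- the labelled block of the backward-shifted bond `⟨x₋−e_ν, dir x⟩` is within `2(d+1)` of that of `x` (dag-n06-c's stencil `stencilB_blkC`).
[cite: Balaban1984PropagatorsII, (2.46) p.231, (2.2) p.224] -/
theorem dist_blkV1_unshift_le (hι : ∀ s, β i.hN i.D i.hk (ιB s) = s) (ν : Fin (d + 1)) (x : FBondY i) :
    (geo9K i).dist (ιB (blkV1 i.hN i.D x)) (ιB (blkV1 i.hN i.D ⟨(shiftsV1 (PV d ℓ i.m i.K hd hL) ν).symm x.src, x.dir⟩)) ≤ 2 * ((d : ℝ) + 1) := by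
  show (geo9K i).dist (blkC i ιB (boxEquiv i.hN x.src)) (blkC i ιB (boxEquiv i.hN ((shiftsV1 (PV d ℓ i.m i.K hd hL) ν).symm x.src))) ≤ _
  rw [boxEquiv_shiftsV1_symm]
  exact stencilB_blkC i ιB hι ν _

omit [NormedRing 𝔸] [NormedAlgebra ℂ 𝔸] [CompleteSpace 𝔸] [Fintype ι] in
/-- ★ the labelled block of `⟨x₋−e_ν, dir x⟩` has length at most `L` times that of the block of `x`, once `2(d+1) < M` (gen 14's `len_blkC_symm_shift_le`: blocks
within `2(d+1)` differ by at most one level). [cite: Balaban1984PropagatorsII, (2.2) p.224 + Lemma 2.1 (2.60) p.234; Balaban1985BackgroundPropagators, p.397 (Δ̃(y))] -/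
theorem len_blkV1_unshift_le (hι : ∀ s, β i.hN i.D i.hk (ιB s) = s) (hdM : 2 * ((d : ℝ) + 1) < (geo9K i).M) (ν : Fin (d + 1)) (x : FBondY i) :
    (geo9K i).len (ιB (blkV1 i.hN i.D ⟨(shiftsV1 (PV d ℓ i.m i.K hd hL) ν).symm x.src, x.dir⟩)) ≤
      ((ℓ + 1 : ℕ) : ℝ) * (geo9K i).len (ιB (blkV1 i.hN i.D x)) := by
  show (geo9K i).len (blkC i ιB (boxEquiv i.hN ((shiftsV1 (PV d ℓ i.m i.K hd hL) ν).symm x.src))) ≤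
    ((ℓ + 1 : ℕ) : ℝ) * (geo9K i).len (blkC i ιB (boxEquiv i.hN x.src))
  rw [boxEquiv_shiftsV1_symm]
  exact len_blkC_symm_shift_le i ιB hι hdM ν _

omit [NormedRing 𝔸] [NormedAlgebra ℂ 𝔸] [CompleteSpace 𝔸] [Fintype ι] in
/-- moving a block by at most `r` costs a factor `e^{|δ|r}` in the decay, for a rate of EITHER sign (the arithmetic of `B5FromB4.exp_shift`, two-sided).
[cite: Balaban1984PropagatorsII, (2.54) p.233, bookkeeping] -/
private theorem exp_neg_le_exp_mul_exp_neg {δ r u v : ℝ} (h₁ : u ≤ r + v) (h₂ : v ≤ r + u) :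
    Real.exp (-(δ * v)) ≤ Real.exp (|δ| * r) * Real.exp (-(δ * u)) := by
  rw [← Real.exp_add]
  apply Real.exp_le_exp.2
  have h3 : |u - v| ≤ r := abs_sub_le_iff.2 ⟨by linarith, by linarith⟩
  have h4 : δ * (u - v) ≤ |δ| * r :=
    (le_abs_self _).trans (by rw [abs_mul]; exact mul_le_mul_of_nonneg_left h3 (abs_nonneg δ))
  rw [mul_sub] at h4
  linarith

omit [NormedRing 𝔸] [NormedAlgebra ℂ 𝔸] [CompleteSpace 𝔸] [Fintype ι] in
/-- `|J| ≥ |J(x)|` for the sup norm of a bond localisation (`B9Thm310CommutatorBound389B.abs_le_supNorm_inr`, restated privately to spare its instance binders).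
[cite: Balaban1985BackgroundPropagators, (3.39) p.397 («|A| = max sup»), bookkeeping] -/
private theorem abs_le_supNorm_inr₀ (J : FBondY i → ℝ) (x : FBondY i) : |J x| ≤ (geo9K i).supNorm (Sum.inr J) :=
  le_ciSup (f := fun x => |J x|) (Set.finite_range _).bddAbove x

end Geometry

/-! ## §3 ★★ The LEFT-BACKWARD cross entry: `‖(∇*_{V,ν}O(V)(J ⊗ E))(x)‖ ≤ L·e^{2(d+1)|δ|}·B₀ℓ(y)e^{−δd(y,y′)}|J|` -/

section Cross

variable {B : B9.Backgrounds} (cfg : B.Cfg → CfgY 𝔸 i) (O : BondOpY 𝔸 i) (par : BondParY 𝔸 i) {B₀ δ : ℝ} {U₁ : B.Cfg}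
  (ιB : BlkY i → IBondY i)

/-- ★★ **THE LEFT-BACKWARD CROSS ENTRY AT ONE CONFIGURATION** (bond sector): from the (3.42) block of NODE 00's bond reading, unit norms of the bond variables and
`2(d+1) < M`: `‖(∇*_{V,ν}O(V)(J ⊗ E))(x)‖ ≤ L·e^{2(d+1)|δ|}·B₀·ℓ(y)·e^{−δd(y,y′)}·|J|` for `‖E‖ ≤ 1`, `supp J ⊂ Δ(βy′)`, `x ∈ Δ(βy)` — print's second member
`∇_U G(U)` read at the neighbour bond `⟨x₋−e_ν, dir x⟩` (block within `2(d+1)` of `Δ(βy)`, one level off at most).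
[cite: Balaban1985BackgroundPropagators, Thm 3.3 p.399 with (3.42) p.397 (second member), (3.8) p.392; Balaban1984PropagatorsII, (2.60) p.234, (2.54) p.233] -/
theorem norm_cdsB_O_le_of_eBlockB_cross (hE : EBlock (kernelFamilyB i B cfg O par) B₀ δ U₁) (hB₀ : 0 ≤ B₀)
    (hι : ∀ s, β i.hN i.D i.hk (ιB s) = s)
    {M₂ : ℝ} (hM₂ : 0 ≤ M₂) (hrepr : ∀ (v : 𝔸) (j : ι), |b.repr v j| ≤ M₂ * ‖v‖)
    (hU1 : ∀ (ν : Fin (d + 1)) (s : Site (PV d ℓ i.m i.K hd hL) 0),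
      ‖((cfg U₁ ν s : 𝔸ˣ) : 𝔸)‖ ≤ 1 ∧ ‖(((cfg U₁ ν s)⁻¹ : 𝔸ˣ) : 𝔸)‖ ≤ 1)
    (hdM : 2 * ((d : ℝ) + 1) < (geo9K i).M)
    (J : FBondY i → ℝ) (y y' : IBondY i) (hs : (geo9K i).suppIn (Sum.inr J) y') {E : 𝔸} (hE1 : ‖E‖ ≤ 1)
    {x : FBondY i} (ν : Fin (d + 1)) (hx : blkV1 i.hN i.D x = β i.hN i.D i.hk y) :
    ‖cdsB i (cfg U₁) ν (O (cfg U₁) (liftY J E)) x‖ ≤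
      ((ℓ + 1 : ℕ) : ℝ) * Real.exp (|δ| * (2 * ((d : ℝ) + 1))) *
        (B₀ * (geo9K i).len y * Real.exp (-(δ * (geo9K i).dist y y')) * (geo9K i).supNorm (Sum.inr J)) := by
  set xm : FBondY i := ⟨(shiftsV1 (PV d ℓ i.m i.K hd hL) ν).symm x.src, x.dir⟩ with hxm
  have hxw : blkV1 i.hN i.D xm = β i.hN i.D i.hk (ιB (blkV1 i.hN i.D xm)) := by rw [hι]
  have h1 := norm_cdB_O_le_of_eBlockB i b cfg O par hE hM₂ hrepr J (ιB (blkV1 i.hN i.D xm)) y' hs hE1 ν hxw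
  have hy : β i.hN i.D i.hk (ιB (blkV1 i.hN i.D x)) = β i.hN i.D i.hk y := by rw [hι, hx]
  have hlen : (geo9K i).len (ιB (blkV1 i.hN i.D xm)) ≤ ((ℓ + 1 : ℕ) : ℝ) * (geo9K i).len y := by
    rw [← geo9K_len_congr i hy]; exact len_blkV1_unshift_le i ιB hι hdM ν x
  have hst : (geo9K i).dist y (ιB (blkV1 i.hN i.D xm)) ≤ 2 * ((d : ℝ) + 1) := by
    rw [← geo9K_dist_congr i hy rfl]; exact dist_blkV1_unshift_le i ιB hι ν x
  have hdist : (geo9K i).dist y y' ≤ 2 * ((d : ℝ) + 1) + (geo9K i).dist (ιB (blkV1 i.hN i.D xm)) y' := by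
    linarith [geo9K_dist_triangle i y (ιB (blkV1 i.hN i.D xm)) y']
  have hdist' : (geo9K i).dist (ιB (blkV1 i.hN i.D xm)) y' ≤ 2 * ((d : ℝ) + 1) + (geo9K i).dist y y' := by
    rw [geo9K_dist_comm] at hst; linarith [geo9K_dist_triangle i (ιB (blkV1 i.hN i.D xm)) y y']
  have hexp := exp_neg_le_exp_mul_exp_neg (δ := δ) hdist hdist'
  have hsup : 0 ≤ (geo9K i).supNorm (Sum.inr J) := (abs_nonneg _).trans (abs_le_supNorm_inr₀ i J x)
  have hleny : 0 ≤ (geo9K i).len y := (geo9K_len_pos i y).le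
  calc ‖cdsB i (cfg U₁) ν (O (cfg U₁) (liftY J E)) x‖
      ≤ ‖cdB i (cfg U₁) ν (O (cfg U₁) (liftY J E)) xm‖ := norm_cdsB_le_norm_cdB_unshift i (cfg U₁) hU1 ν _ x
    _ ≤ B₀ * (geo9K i).len (ιB (blkV1 i.hN i.D xm)) * Real.exp (-(δ * (geo9K i).dist (ιB (blkV1 i.hN i.D xm)) y')) *
          (geo9K i).supNorm (Sum.inr J) := h1
    _ ≤ B₀ * (((ℓ + 1 : ℕ) : ℝ) * (geo9K i).len y) * (Real.exp (|δ| * (2 * ((d : ℝ) + 1))) * Real.exp (-(δ * (geo9K i).dist y y'))) *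
          (geo9K i).supNorm (Sum.inr J) := by
        gcongr
    _ = _ := by ring

/-! ## §4 ★★ The RIGHT-FORWARD cross entry: `‖(O(V)∇_{V,ν}(J ⊗ E))(x)‖ ≤ m_N·M₂(Σ_j‖b_j‖)·e^{2(d+1)|δ|}·B₀ℓ(y)e^{−δd(y,y′)}|J|` -/

/-- ★★ **THE RIGHT-FORWARD CROSS ENTRY AT ONE CONFIGURATION** (bond sector): from the (3.42) block of NODE 00's bond reading, unit norms of the bond variables and
a bound `m_N` on the number of index bonds within `2(d+1)` of a bond: `‖(O(V)∇_{V,ν}(J ⊗ E))(x)‖ ≤ m_N·M₂(Σ_j‖b_j‖)·e^{2(d+1)|δ|}·B₀·ℓ(y)·e^{−δd(y,y′)}·|J|` for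
`‖E‖ ≤ 1`, `supp J ⊂ Δ(βy′)`, `x ∈ Δ(βy)` — `∇_ν = −∇*_ν∘T_ν`, the transported amplitude `T_ν(J ⊗ E) = Σ_j g_j ⊗ b_j` split into its block pieces over the
neighbourhood of `y′`, and print's third member `G(U)∇*_U` applied to each piece.
[cite: Balaban1985BackgroundPropagators, Thm 3.3 p.399 with (3.42) p.397 (third member), (3.3) p.390, (3.8) p.392; Balaban1984PropagatorsII, (2.51) p.232, (2.61) p.234, (2.54) p.233] -/
theorem norm_O_cdB_le_of_eBlockB_cross [Fintype (geo9K i).Site] (hE : EBlock (kernelFamilyB i B cfg O par) B₀ δ U₁) (hB₀ : 0 ≤ B₀)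
    (hι : ∀ s, β i.hN i.D i.hk (ιB s) = s)
    {M₂ : ℝ} (hM₂ : 0 ≤ M₂) (hrepr : ∀ (v : 𝔸) (j : ι), |b.repr v j| ≤ M₂ * ‖v‖)
    (hU1 : ∀ (ν : Fin (d + 1)) (s : Site (PV d ℓ i.m i.K hd hL) 0),
      ‖((cfg U₁ ν s : 𝔸ˣ) : 𝔸)‖ ≤ 1 ∧ ‖(((cfg U₁ ν s)⁻¹ : 𝔸ˣ) : 𝔸)‖ ≤ 1)
    {mN : ℕ} (hnbr : ∀ y' : IBondY i, (nbr (geo9K i) (2 * ((d : ℝ) + 1)) y').card ≤ mN)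
    (J : FBondY i → ℝ) (y y' : IBondY i) (hs : (geo9K i).suppIn (Sum.inr J) y') {E : 𝔸} (hE1 : ‖E‖ ≤ 1)
    {x : FBondY i} (ν : Fin (d + 1)) (hx : blkV1 i.hN i.D x = β i.hN i.D i.hk y) :
    ‖O (cfg U₁) (cdB i (cfg U₁) ν (liftY J E)) x‖ ≤
      ((mN : ℝ) * (M₂ * ∑ j, ‖b j‖) * Real.exp (|δ| * (2 * ((d : ℝ) + 1)))) *
        (B₀ * (geo9K i).len y * Real.exp (-(δ * (geo9K i).dist y y')) * (geo9K i).supNorm (Sum.inr J)) := by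
  classical
  have hsup : 0 ≤ (geo9K i).supNorm (Sum.inr J) := (abs_nonneg _).trans (abs_le_supNorm_inr₀ i J x)
  have hleny : 0 ≤ (geo9K i).len y := (geo9K_len_pos i y).le
  -- the neighbourhood of the input block and the pieces of the transported amplitude
  set T : Finset (IBondY i) := nbr (geo9K i) (2 * ((d : ℝ) + 1)) y' with hT
  set g : ι → FBondY i → ℝ := fun j x' =>
    J ⟨shiftsV1 (PV d ℓ i.m i.K hd hL) ν x'.src, x'.dir⟩ * b.repr (R (cfg U₁ ν x'.src) E) j with hg
  set gp : ι → IBondY i → FBondY i → ℝ := fun j a x' => if ιB (blkV1 i.hN i.D x') = a then g j x' else 0 with hgp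
  -- (i) where `g_j ≠ 0` the block is in the neighbourhood of `y′`
  have hmemT : ∀ j x', g j x' ≠ 0 → ιB (blkV1 i.hN i.D x') ∈ T := by
    intro j x' hx'
    have hJ : J ⟨shiftsV1 (PV d ℓ i.m i.K hd hL) ν x'.src, x'.dir⟩ ≠ 0 := fun h0 => hx' (by simp only [hg, h0, zero_mul])
    have hblk : blkV1 i.hN i.D ⟨shiftsV1 (PV d ℓ i.m i.K hd hL) ν x'.src, x'.dir⟩ = β i.hN i.D i.hk y' := hs _ hJ
    have hc : β i.hN i.D i.hk (ιB (blkV1 i.hN i.D ⟨shiftsV1 (PV d ℓ i.m i.K hd hL) ν x'.src, x'.dir⟩)) = β i.hN i.D i.hk y' := by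
      rw [hι, hblk]
    refine mem_nbr.2 ?_
    rw [← geo9K_dist_congr i rfl hc]
    exact dist_blkV1_shift_le i ιB hι ν x'
  -- (ii) `g_j` is the sum of its pieces over the neighbourhood
  have hsplit : ∀ j, g j = ∑ a ∈ T, gp j a := by
    intro j; funext x'
    rw [Finset.sum_apply]
    show g j x' = ∑ a ∈ T, (if ιB (blkV1 i.hN i.D x') = a then g j x' else 0)
    by_cases hx' : g j x' = 0
    · rw [hx']; symm
      exact Finset.sum_eq_zero fun a _ => ite_self 0
    · rw [Finset.sum_ite_eq, if_pos (hmemT j x' hx')]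
  -- (iii) the transported amplitude as a double sum of amplitudes
  have hΨ : (fun x' : FBondY i => R (cfg U₁ ν x'.src) (liftY J E ⟨shiftsV1 (PV d ℓ i.m i.K hd hL) ν x'.src, x'.dir⟩))
      = ∑ j, ∑ a ∈ T, liftY (gp j a) (b j) := by
    rw [transportB_liftY_eq_sum i b (cfg U₁) ν J E]
    refine Finset.sum_congr rfl fun j _ => ?_
    show liftY (g j) (b j) = _
    rw [hsplit j, liftY_finset_sum]
  -- (iv) the operator identity `O(V)∇_ν(J ⊗ E) = −Σ_j Σ_a O(V)∇*_ν(g_{j,a} ⊗ b_j)`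
  have hlin : ∀ {S : Type} (s : Finset S) (h : S → FBondY i → 𝔸),
      O (cfg U₁) (cdsB i (cfg U₁) ν (∑ a ∈ s, h a)) = ∑ a ∈ s, O (cfg U₁) (cdsB i (cfg U₁) ν (h a)) := by
    intro S s h
    have hms := map_sum ((O (cfg U₁)).restrictScalars ℝ ∘ₗ cdsBₗ i (cfg U₁) ν) h s
    simpa only [LinearMap.coe_comp, Function.comp_apply, LinearMap.coe_restrictScalars, cdsBₗ_apply] using hms
  have hop : O (cfg U₁) (cdB i (cfg U₁) ν (liftY J E)) x = -(∑ j, ∑ a ∈ T, O (cfg U₁) (cdsB i (cfg U₁) ν (liftY (gp j a) (b j))) x) := by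
    rw [cdB_eq_neg_cdsB_transport i (cfg U₁) ν, map_neg, hΨ, hlin, Pi.neg_apply, Finset.sum_apply]
    congr 1
    refine Finset.sum_congr rfl fun j _ => ?_
    rw [hlin, Finset.sum_apply]
  -- (v) each piece: print's third member at the block `a`, the amplitude `b_j` rescaled into the ball
  have hpiece : ∀ j, ∀ a ∈ T, ‖O (cfg U₁) (cdsB i (cfg U₁) ν (liftY (gp j a) (b j))) x‖
      ≤ ‖b j‖ * (B₀ * (geo9K i).len y * Real.exp (-(δ * (geo9K i).dist y a)) * (M₂ * (geo9K i).supNorm (Sum.inr J))) := by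
    intro j a _
    have hsa : (geo9K i).suppIn (Sum.inr (gp j a)) a := by
      intro x' hx'
      have hxa : ιB (blkV1 i.hN i.D x') = a := by
        by_contra hne
        exact hx' (show (if ιB (blkV1 i.hN i.D x') = a then g j x' else 0) = 0 by rw [if_neg hne])
      show blkV1 i.hN i.D x' = β i.hN i.D i.hk a
      rw [← hxa, hι]
    have hgsup : (geo9K i).supNorm (Sum.inr (gp j a)) ≤ M₂ * (geo9K i).supNorm (Sum.inr J) := by
      refine Real.iSup_le (fun x' => ?_) (mul_nonneg hM₂ hsup)
      show |(if ιB (blkV1 i.hN i.D x') = a then g j x' else 0)| ≤ _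
      by_cases hxa : ιB (blkV1 i.hN i.D x') = a
      · rw [if_pos hxa]
        show |J ⟨shiftsV1 (PV d ℓ i.m i.K hd hL) ν x'.src, x'.dir⟩ * b.repr (R (cfg U₁ ν x'.src) E) j| ≤ _
        rw [abs_mul]
        have hR : ‖R (cfg U₁ ν x'.src) E‖ ≤ 1 := (norm_R_le (hU1 ν _).1 (hU1 ν _).2 E).trans hE1
        calc |J ⟨shiftsV1 (PV d ℓ i.m i.K hd hL) ν x'.src, x'.dir⟩| * |b.repr (R (cfg U₁ ν x'.src) E) j|
            ≤ (geo9K i).supNorm (Sum.inr J) * (M₂ * ‖R (cfg U₁ ν x'.src) E‖) :=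
              mul_le_mul (abs_le_supNorm_inr₀ i J _) (hrepr _ _) (abs_nonneg _) hsup
          _ ≤ (geo9K i).supNorm (Sum.inr J) * (M₂ * 1) := by gcongr
          _ = M₂ * (geo9K i).supNorm (Sum.inr J) := by ring
      · rw [if_neg hxa, abs_zero]; exact mul_nonneg hM₂ hsup
    have hF : ∀ (c : ℂ) (E' : 𝔸), O (cfg U₁) (cdsB i (cfg U₁) ν (liftY (gp j a) (c • E'))) x =
        c • O (cfg U₁) (cdsB i (cfg U₁) ν (liftY (gp j a) E')) x := by
      intro c E'; rw [liftY_smul_right, cdsB_smul, map_smul, Pi.smul_apply]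
    have hX0 : 0 ≤ B₀ * (geo9K i).len y * Real.exp (-(δ * (geo9K i).dist y a)) := by positivity
    have hball : ∀ E' : 𝔸, ‖E'‖ ≤ 1 → ‖O (cfg U₁) (cdsB i (cfg U₁) ν (liftY (gp j a) E')) x‖ ≤
        B₀ * (geo9K i).len y * Real.exp (-(δ * (geo9K i).dist y a)) * (M₂ * (geo9K i).supNorm (Sum.inr J)) := by
      intro E' hE'
      have h2 := norm_O_cdsB_le_of_eBlockB i b cfg O par hE hM₂ hrepr (gp j a) y a hsa hE' ν hx
      exact h2.trans (mul_le_mul_of_nonneg_left hgsup hX0)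
    exact norm_le_norm_mul_of_ball (fun E' => O (cfg U₁) (cdsB i (cfg U₁) ν (liftY (gp j a) E')) x) hF hball (b j)
  -- (vi) the decay at a neighbourhood block versus the decay at `y′`
  have hexpa : ∀ a ∈ T, Real.exp (-(δ * (geo9K i).dist y a)) ≤
      Real.exp (|δ| * (2 * ((d : ℝ) + 1))) * Real.exp (-(δ * (geo9K i).dist y y')) := by
    intro a ha
    have ha' : (geo9K i).dist a y' ≤ 2 * ((d : ℝ) + 1) := mem_nbr.1 ha
    have ha'' : (geo9K i).dist y' a ≤ 2 * ((d : ℝ) + 1) := by rwa [geo9K_dist_comm]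
    exact exp_neg_le_exp_mul_exp_neg (δ := δ) (by linarith [geo9K_dist_triangle i y a y']) (by linarith [geo9K_dist_triangle i y y' a])
  -- (vii) assemble
  have hsum : ‖O (cfg U₁) (cdB i (cfg U₁) ν (liftY J E)) x‖ ≤
      ∑ j, ∑ a ∈ T, ‖O (cfg U₁) (cdsB i (cfg U₁) ν (liftY (gp j a) (b j))) x‖ := by
    rw [hop, norm_neg]
    exact (norm_sum_le _ _).trans (Finset.sum_le_sum fun j _ => norm_sum_le _ _)
  calc ‖O (cfg U₁) (cdB i (cfg U₁) ν (liftY J E)) x‖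
      ≤ ∑ j, ∑ a ∈ T, ‖O (cfg U₁) (cdsB i (cfg U₁) ν (liftY (gp j a) (b j))) x‖ := hsum
    _ ≤ ∑ j, ∑ a ∈ T, ‖b j‖ * (B₀ * (geo9K i).len y * (Real.exp (|δ| * (2 * ((d : ℝ) + 1))) * Real.exp (-(δ * (geo9K i).dist y y'))) *
          (M₂ * (geo9K i).supNorm (Sum.inr J))) :=
        Finset.sum_le_sum fun j _ => Finset.sum_le_sum fun a ha => (hpiece j a ha).trans (by gcongr; exact hexpa a ha)
    _ = ∑ j, (T.card : ℝ) * (‖b j‖ * (B₀ * (geo9K i).len y * (Real.exp (|δ| * (2 * ((d : ℝ) + 1))) * Real.exp (-(δ * (geo9K i).dist y y'))) *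
          (M₂ * (geo9K i).supNorm (Sum.inr J)))) := by
        simp only [Finset.sum_const, nsmul_eq_mul]
    _ ≤ ∑ j, (mN : ℝ) * (‖b j‖ * (B₀ * (geo9K i).len y * (Real.exp (|δ| * (2 * ((d : ℝ) + 1))) * Real.exp (-(δ * (geo9K i).dist y y'))) *
          (M₂ * (geo9K i).supNorm (Sum.inr J)))) :=
        Finset.sum_le_sum fun j _ => mul_le_mul_of_nonneg_right (Nat.cast_le.2 (hnbr y')) (by positivity)
    _ = _ := by rw [← Finset.mul_sum, ← Finset.sum_mul]; ring

end Cross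

/-! ## §5 ★★ The two WANTED (2.51) block majorants of the conj-`b` cross letters on the bond carrier `FBondY × ι` -/

section Majorants

variable {B : B9.Backgrounds} (cfg : B.Cfg → CfgY 𝔸 i) (O : BondOpY 𝔸 i) (par : BondParY 𝔸 i) {B₀ δ : ℝ} {U₁ : B.Cfg}
variable [Fintype (geo9K i).Site] {Rr : ℝ} {Hp : Prop}

/-- ★★ **READ, left-backward cross ⇒ the majorant of `conj b (∇*_{V,ν} ∘ O(V))`** with constant `L·e^{2(d+1)|δ|}·B₀` (inside `M₂(Σ_j‖b_j‖)·(…)`), profile `ℓ(a)`,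
SAME rate `δ` — the first cross slot of r06's `GFrame₄.readG342` on the bond sector, in the shape of `B9SectBGReadY.hasMajorant_conj_cdB_O_of_eBlockB`.
[cite: Balaban1985BackgroundPropagators, Thm 3.3 p.399 with (3.42) p.397, (3.8) p.392; Balaban1984PropagatorsII, (2.51)–(2.52) p.232, (2.60) p.234] -/
theorem hasMajorant_conj_cdsB_O_of_eBlockB (hE : EBlock (kernelFamilyB i B cfg O par) B₀ δ U₁) (hB₀ : 0 ≤ B₀)
    (ιB : BlkY i → IBondY i) (hι : ∀ s, β i.hN i.D i.hk (ιB s) = s)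
    {M₂ : ℝ} (hM₂ : 0 ≤ M₂) (hrepr : ∀ (v : 𝔸) (j : ι), |b.repr v j| ≤ M₂ * ‖v‖)
    (hU1 : ∀ (ν : Fin (d + 1)) (s : Site (PV d ℓ i.m i.K hd hL) 0),
      ‖((cfg U₁ ν s : 𝔸ˣ) : 𝔸)‖ ≤ 1 ∧ ‖(((cfg U₁ ν s)⁻¹ : 𝔸ˣ) : 𝔸)‖ ≤ 1)
    (hdM : 2 * ((d : ℝ) + 1) < (geo9K i).M) (ν : Fin (d + 1)) :
    HasMajorant (g := toB6 (geo9K i) Rr Hp) (fun p : FBondY i × ι => ιB (blkV1 i.hN i.D p.1))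
      (conj b (cdsBₗ i (cfg U₁) ν ∘ₗ (O (cfg U₁)).restrictScalars ℝ))
      (fun a a' => M₂ * (∑ j, ‖b j‖) *
        ((((ℓ + 1 : ℕ) : ℝ) * Real.exp (|δ| * (2 * ((d : ℝ) + 1))) * B₀) * (geo9K i).len a * Real.exp (-(δ * (geo9K i).dist a a')))) := by
  have hC0 : 0 ≤ ((ℓ + 1 : ℕ) : ℝ) * Real.exp (|δ| * (2 * ((d : ℝ) + 1))) := by positivity
  have h := hasMajorant_conj_of_ball_boundB (Rr := Rr) (Hp := Hp) i b (cdsBₗ i (cfg U₁) ν ∘ₗ (O (cfg U₁)).restrictScalars ℝ)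
    (fun c Λ => by
      rw [LinearMap.comp_apply, LinearMap.comp_apply, LinearMap.restrictScalars_apply, LinearMap.restrictScalars_apply, map_smul, cdsBₗ_apply,
        cdsBₗ_apply, cdsB_smul])
    ιB hι hM₂ hrepr
    (fun a a' => ((ℓ + 1 : ℕ) : ℝ) * Real.exp (|δ| * (2 * ((d : ℝ) + 1))) * (B₀ * (geo9K i).len a * Real.exp (-(δ * (geo9K i).dist a a'))))
    (fun a a' => mul_nonneg hC0 (mul_nonneg (mul_nonneg hB₀ (geo9K_len_pos i a).le) (Real.exp_pos _).le))
    fun J y y' hs _ hE1 _ hx => by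
      rw [LinearMap.comp_apply, cdsBₗ_apply]
      exact (norm_cdsB_O_le_of_eBlockB_cross i b cfg O par ιB hE hB₀ hι hM₂ hrepr hU1 hdM J y y' hs hE1 ν hx).trans (le_of_eq (by ring))
  exact hasMajorant_mono _ h fun a a' => le_of_eq (by ring)

/-- ★★ **READ, right-forward cross ⇒ the majorant of `conj b (O(V) ∘ ∇_{V,ν})`** with constant `m_N·M₂(Σ_j‖b_j‖)·e^{2(d+1)|δ|}·B₀`, profile `ℓ(a)`, SAME rate
`δ` — the second cross slot of r06's `GFrame₄.readG342` on the bond sector, in the shape of `B9SectBGReadY.hasMajorant_conj_O_cdsB_of_eBlockB`.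
[cite: Balaban1985BackgroundPropagators, Thm 3.3 p.399 with (3.42) p.397, (3.3) p.390; Balaban1984PropagatorsII, (2.51)–(2.52) p.232, (2.61) p.234] -/
theorem hasMajorant_conj_O_cdB_of_eBlockB (hE : EBlock (kernelFamilyB i B cfg O par) B₀ δ U₁) (hB₀ : 0 ≤ B₀)
    (ιB : BlkY i → IBondY i) (hι : ∀ s, β i.hN i.D i.hk (ιB s) = s)
    {M₂ : ℝ} (hM₂ : 0 ≤ M₂) (hrepr : ∀ (v : 𝔸) (j : ι), |b.repr v j| ≤ M₂ * ‖v‖)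
    (hU1 : ∀ (ν : Fin (d + 1)) (s : Site (PV d ℓ i.m i.K hd hL) 0),
      ‖((cfg U₁ ν s : 𝔸ˣ) : 𝔸)‖ ≤ 1 ∧ ‖(((cfg U₁ ν s)⁻¹ : 𝔸ˣ) : 𝔸)‖ ≤ 1)
    {mN : ℕ} (hnbr : ∀ y' : IBondY i, (nbr (geo9K i) (2 * ((d : ℝ) + 1)) y').card ≤ mN) (ν : Fin (d + 1)) :
    HasMajorant (g := toB6 (geo9K i) Rr Hp) (fun p : FBondY i × ι => ιB (blkV1 i.hN i.D p.1))
      (conj b ((O (cfg U₁)).restrictScalars ℝ ∘ₗ cdBₗ i (cfg U₁) ν))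
      (fun a a' => M₂ * (∑ j, ‖b j‖) *
        ((((mN : ℝ) * (M₂ * ∑ j, ‖b j‖) * Real.exp (|δ| * (2 * ((d : ℝ) + 1)))) * B₀) * (geo9K i).len a *
          Real.exp (-(δ * (geo9K i).dist a a')))) := by
  have hC0 : 0 ≤ (mN : ℝ) * (M₂ * ∑ j, ‖b j‖) * Real.exp (|δ| * (2 * ((d : ℝ) + 1))) := by positivity
  have h := hasMajorant_conj_of_ball_boundB (Rr := Rr) (Hp := Hp) i b ((O (cfg U₁)).restrictScalars ℝ ∘ₗ cdBₗ i (cfg U₁) ν)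
    (fun c Λ => by
      rw [LinearMap.comp_apply, LinearMap.comp_apply, LinearMap.restrictScalars_apply, LinearMap.restrictScalars_apply, cdBₗ_apply, cdBₗ_apply,
        cdB_smul, map_smul])
    ιB hι hM₂ hrepr
    (fun a a' => ((mN : ℝ) * (M₂ * ∑ j, ‖b j‖) * Real.exp (|δ| * (2 * ((d : ℝ) + 1)))) *
      (B₀ * (geo9K i).len a * Real.exp (-(δ * (geo9K i).dist a a'))))
    (fun a a' => mul_nonneg hC0 (mul_nonneg (mul_nonneg hB₀ (geo9K_len_pos i a).le) (Real.exp_pos _).le))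
    fun J y y' hs _ hE1 _ hx => by
      rw [LinearMap.comp_apply, LinearMap.restrictScalars_apply, cdBₗ_apply]
      exact (norm_O_cdB_le_of_eBlockB_cross i b cfg O par ιB hE hB₀ hι hM₂ hrepr hU1 hnbr J y y' hs hE1 ν hx).trans (le_of_eq (by ring))
  exact hasMajorant_mono _ h fun a a' => le_of_eq (by ring)

end Majorants

end Literature.MathematicalPhysics.QuantumFieldTheory.Balaban1983to89.Node00.OpsYRead342CrossB
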